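import Mathlib
import Summits.Ventures.PercRepro2.StrandSplit
import Summits.Ventures.PercRepro2.IFRConv
import Summits.Ventures.PercRepro2.IFRSP

/-!
# Strand reduction for row B2: the flow of a parallel composition is the sum of the flows of its
parts, and log-concave tails are closed under convolution (seat mine-b, cell pub-perc-repro2)

With the splitting lemmas of `StrandSplit.lean`, the flow tail of `E₁ ∪ E₂` (parts sharing only
the terminals) is the convolution of the two tails (`prob_flowEvent_eq_sum`,
`flowTail_univ_eq_Hsum` = `IFR.Hsum`), hence log-concave when both parts' tails are
(`isLCTail_flowTail_union`, `flow_logconcave_of_parts`): **row B2 reduces to the strands of a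
graph** (the components of `G − {s,t}` with their attachments and the direct `s–t` edges).  A
strand with no three disjoint carrying sets has a log-concave tail by the BK inequality alone
(`prob_flowIn_two_le`, `flowIn_logconcave_of_no_three`), so row B2 holds for every product measure
on a parallel composition of two parts each carrying at most two edge-disjoint `s–t` paths
(`flow_logconcave_of_two_small_parts`; `K₄` with adjacent terminals = a direct edge ∥ the
Wheatstone bridge is the smallest instance — the first non-series–parallel case of row B2;
proofs/MINE-B-DUAL.md §7).
-/

open Finset

namespace Summit.Ventures.PercRepro2
section Tails

open IFR

variable {V : Type*} {E : Type*} [Fintype E] [DecidableEq E]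

/-- the flow tail of a part as a function on `ℤ`: `P(F₁ ≥ k)`, `1` for `k ≤ 0` -/
noncomputable def flowTail (p : E → ℝ) (ends : E → Sym2 V) (s t : V) (E₁ : Finset E) (k : ℤ) : ℝ :=
  if k ≤ 0 then 1 else prob p (flowIn ends s t E₁ k.toNat)

/-- the tail is `1` at nonpositive indices -/
lemma flowTail_of_nonpos (p : E → ℝ) (ends : E → Sym2 V) (s t : V) (E₁ : Finset E) {k : ℤ}
    (hk : k ≤ 0) : flowTail p ends s t E₁ k = 1 := by simp [flowTail, hk]

/-- the tail at a positive index is the flow probability -/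
lemma flowTail_of_pos (p : E → ℝ) (ends : E → Sym2 V) (s t : V) (E₁ : Finset E) {k : ℤ}
    (hk : 0 < k) : flowTail p ends s t E₁ k = prob p (flowIn ends s t E₁ k.toNat) := by
  simp [flowTail, not_le.2 hk]

/-- the tail at a natural index -/
lemma flowTail_natCast (p : E → ℝ) (ends : E → Sym2 V) (s t : V) (E₁ : Finset E) (k : ℕ) :
    flowTail p ends s t E₁ (k : ℤ) = prob p (flowIn ends s t E₁ k) := by
  rcases Nat.eq_zero_or_pos k with h | h
  · subst h; simp [flowTail, flowIn_zero]
  · rw [flowTail_of_pos _ _ _ _ _ (by exact_mod_cast h)]; simp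

/-- `P(F₁ = j) = P(F₁ ≥ j) − P(F₁ ≥ j+1)` -/
lemma prob_flowLevel (p : E → ℝ) (ends : E → Sym2 V) (s t : V) (E₁ : Finset E) (j : ℕ) :
    prob p (flowLevel ends s t E₁ j) = prob p (flowIn ends s t E₁ j) - prob p (flowIn ends s t E₁ (j + 1)) := by
  have h := prob_union_of_disjoint p (A := flowIn ends s t E₁ (j + 1)) (B := flowLevel ends s t E₁ j)
    (Set.disjoint_sdiff_right)
  have hu : flowIn ends s t E₁ (j + 1) ∪ flowLevel ends s t E₁ j = flowIn ends s t E₁ j := by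
    unfold flowLevel
    exact Set.union_sdiff_cancel (flowIn_succ_subset ends s t E₁ j)
  rw [hu] at h
  linarith

/-- the pmf of the flow tail at a natural index is the level probability -/
lemma pmf_flowTail (p : E → ℝ) (ends : E → Sym2 V) (s t : V) (E₁ : Finset E) (j : ℕ) :
    IsLCTail.pmf (flowTail p ends s t E₁) (j : ℤ) = prob p (flowLevel ends s t E₁ j) := by
  unfold IsLCTail.pmf
  rw [prob_flowLevel, flowTail_natCast]
  have : ((j : ℤ) + 1) = ((j + 1 : ℕ) : ℤ) := by push_cast; ring
  rw [this, flowTail_natCast]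

/-- **the flow tail of a parallel composition is the convolution of the tails of the parts**:
`P(F ≥ k) = Σ_j P(F₁ = j) · P(F₂ ≥ k − j)` -/
theorem prob_flowEvent_eq_sum (p : E → ℝ) {ends : E → Sym2 V} {s t : V} (hst : s ≠ t)
    {E₁ E₂ : Finset E} (hE : SharesOnlyTerminals ends s t E₁ E₂) (hdisj : Disjoint E₁ E₂)
    (hcov : E₁ ∪ E₂ = Finset.univ) (k : ℕ) :
    prob p (flowEvent ends s t k)
      = ∑ j ∈ Finset.range (E₁.card + 1), prob p (flowLevel ends s t E₁ j) * prob p (flowIn ends s t E₂ (k - j)) := by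
  have h0 : prob p (flowEvent ends s t k)
      = prob p (flowEvent ends s t k ∩ (flowIn ends s t E₁ (E₁.card + 1))ᶜ) := by
    rw [flowIn_eq_empty hst E₁ (Nat.lt_succ_self _), Set.compl_empty, Set.inter_univ]
  rw [h0, prob_inter_compl_flowIn_eq_sum]
  refine Finset.sum_congr rfl fun j _ => ?_
  rw [Set.inter_comm, flowLevel_inter_flowEvent hst hE hdisj hcov k j]
  exact prob_inter_eq_mul_of_dependsOn p (Finset.disjoint_coe.2 hdisj)
    (dependsOn_flowLevel ends s t E₁ j) (dependsOn_flowIn ends s t E₂ (k - j))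

/-- the same identity in the language of `IFR.Hsum` (for `k ≥ 0`, `M > |E₁|`) -/
theorem flowTail_univ_eq_Hsum (p : E → ℝ) {ends : E → Sym2 V} {s t : V} (hst : s ≠ t)
    {E₁ E₂ : Finset E} (hE : SharesOnlyTerminals ends s t E₁ E₂) (hdisj : Disjoint E₁ E₂)
    (hcov : E₁ ∪ E₂ = Finset.univ) {M : ℤ} (hM : (E₁.card : ℤ) + 1 ≤ M) (k : ℕ) :
    flowTail p ends s t Finset.univ (k : ℤ)
      = Hsum (flowTail p ends s t E₂) (flowTail p ends s t E₁) M (k : ℤ) := by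
  rw [flowTail_natCast, flowIn_univ, prob_flowEvent_eq_sum p hst hE hdisj hcov k]
  unfold Hsum
  -- restrict the integer sum to the image of `range (|E₁| + 1)`
  have hsub : (Finset.range (E₁.card + 1)).image (Nat.cast : ℕ → ℤ) ⊆ I M := by
    intro x hx
    rw [Finset.mem_image] at hx
    obtain ⟨j, hj, rfl⟩ := hx
    rw [Finset.mem_range] at hj
    unfold I; rw [Finset.mem_Icc]; omega
  rw [← Finset.sum_subset hsub, Finset.sum_image (fun _ _ _ _ h => Nat.cast_injective h)]
  · refine Finset.sum_congr rfl fun j _ => ?_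
    rw [pmf_flowTail]
    congr 1
    -- `flowTail E₂ (k − j) = P(F₂ ≥ k − j)` with truncated subtraction
    by_cases hjk : j ≤ k
    · have e : ((k : ℤ) - (j : ℤ)) = ((k - j : ℕ) : ℤ) := by omega
      rw [e, flowTail_natCast]
    · have hlt : k < j := Nat.lt_of_not_le hjk
      rw [flowTail_of_nonpos _ _ _ _ _ (by omega), Nat.sub_eq_zero_of_le hlt.le, flowIn_zero, prob_univ]
  · -- the terms outside the image vanish
    intro x hxI hx
    have hx' : ∀ j ∈ Finset.range (E₁.card + 1), (j : ℤ) ≠ x := by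
      intro j hj h
      exact hx (Finset.mem_image.2 ⟨j, hj, h⟩)
    rcases lt_or_ge x 0 with hneg | hpos
    · rw [IsLCTail.pmf, flowTail_of_nonpos _ _ _ _ _ (by omega), flowTail_of_nonpos _ _ _ _ _ (by omega)]
      ring
    · -- `x ≥ |E₁| + 1`: both tails vanish
      have hbig : (E₁.card : ℤ) + 1 ≤ x := by
        by_contra hlt
        have hlt' : x < (E₁.card : ℤ) + 1 := not_le.1 hlt
        have hxn : x = ((x.toNat : ℕ) : ℤ) := (Int.toNat_of_nonneg hpos).symm
        apply hx' x.toNat (by rw [Finset.mem_range]; omega)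
        exact hxn.symm
      have hv : ∀ y : ℤ, (E₁.card : ℤ) + 1 ≤ y → flowTail p ends s t E₁ y = 0 := by
        intro y hy
        rw [flowTail_of_pos _ _ _ _ _ (by omega), flowIn_eq_empty hst E₁ (by omega), prob_empty]
      rw [IsLCTail.pmf, hv x hbig, hv (x + 1) (by omega)]
      ring

/-- the flow tail of a part is a log-concave tail as soon as it is log-concave at every level
(the hypothesis of the reduction: row B2 for the part) -/
theorem isLCTail_flowTail {p : E → ℝ} (hp : IsProbVec p) {ends : E → Sym2 V} {s t : V} (hst : s ≠ t)
    (E₁ : Finset E)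
    (hlc : ∀ k : ℕ, prob p (flowIn ends s t E₁ k) * prob p (flowIn ends s t E₁ (k + 2))
      ≤ prob p (flowIn ends s t E₁ (k + 1)) * prob p (flowIn ends s t E₁ (k + 1))) :
    IsLCTail (flowTail p ends s t E₁) ((E₁.card : ℤ) + 1) where
  one := fun k hk => flowTail_of_nonpos _ _ _ _ _ hk
  nonneg := by
    intro k
    unfold flowTail
    split_ifs
    · exact zero_le_one
    · exact prob_nonneg hp _
  anti := by
    intro k
    rcases le_or_gt k (-1) with hk | hk
    · rw [flowTail_of_nonpos _ _ _ _ _ (by omega), flowTail_of_nonpos _ _ _ _ _ (by omega)]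
    · rcases eq_or_lt_of_le (show 0 ≤ k by omega) with h0 | hpos
      · subst h0
        rw [flowTail_of_nonpos _ _ _ _ _ le_rfl]
        unfold flowTail
        simp only [show ¬ ((0 : ℤ) + 1 ≤ 0) by norm_num, if_false]
        exact prob_le_one hp _
      · rw [flowTail_of_pos _ _ _ _ _ hpos, flowTail_of_pos _ _ _ _ _ (by omega)]
        apply prob_mono hp
        have e : (k + 1).toNat = k.toNat + 1 := by omega
        rw [e]
        exact flowIn_succ_subset ends s t E₁ _
  lc := by
    intro k
    rcases le_or_gt k (-1) with hk | hk
    · rw [flowTail_of_nonpos _ _ _ _ _ (by omega), flowTail_of_nonpos _ _ _ _ _ (by omega),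
        flowTail_of_nonpos _ _ _ _ _ (by omega)]
    · rcases eq_or_lt_of_le (show 0 ≤ k by omega) with h0 | hpos
      · subst h0
        rw [flowTail_of_nonpos _ _ _ _ _ (by norm_num), flowTail_of_nonpos _ _ _ _ _ le_rfl]
        rw [flowTail_of_pos _ _ _ _ _ (by norm_num)]
        have := prob_le_one hp (flowIn ends s t E₁ ((0 : ℤ) + 1).toNat)
        have h2 := prob_nonneg hp (flowIn ends s t E₁ ((0 : ℤ) + 1).toNat)
        nlinarith
      · -- `k ≥ 1`: the hypothesis at level `k − 1`
        obtain ⟨n, rfl⟩ : ∃ n : ℕ, k = ((n : ℕ) : ℤ) + 1 := ⟨(k - 1).toNat, by omega⟩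
        have e1 : ((n : ℤ) + 1 - 1) = (n : ℤ) := by ring
        have e2 : ((n : ℤ) + 1 + 1) = ((n + 2 : ℕ) : ℤ) := by push_cast; ring
        have e3 : ((n : ℤ) + 1) = ((n + 1 : ℕ) : ℤ) := by push_cast; ring
        rw [e1, e2, e3, flowTail_natCast, flowTail_natCast, flowTail_natCast]
        exact hlc n
  vanish := by
    intro k hk
    rw [flowTail_of_pos _ _ _ _ _ (by omega), flowIn_eq_empty hst E₁ (by omega), prob_empty]

end Tails

section Main

open IFR

variable {V : Type*} {E : Type*} [Fintype E] [DecidableEq E]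

/-- the convolution identity holds for every integer index (for `k ≤ 0` both sides are `1`) -/
theorem flowTail_univ_eq_Hsum_all (p : E → ℝ) {ends : E → Sym2 V} {s t : V} (hst : s ≠ t)
    {E₁ E₂ : Finset E} (hE : SharesOnlyTerminals ends s t E₁ E₂) (hdisj : Disjoint E₁ E₂)
    (hcov : E₁ ∪ E₂ = Finset.univ) {M : ℤ} (hM : (E₁.card : ℤ) + 1 ≤ M) (k : ℤ) :
    flowTail p ends s t Finset.univ k = Hsum (flowTail p ends s t E₂) (flowTail p ends s t E₁) M k := by
  rcases le_or_gt k 0 with hk | hk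
  · -- both sides equal the value at `0`
    have h0 := flowTail_univ_eq_Hsum p hst hE hdisj hcov hM 0
    simp only [Nat.cast_zero] at h0
    rw [flowTail_of_nonpos _ _ _ _ _ hk, flowTail_of_nonpos _ _ _ _ _ le_rfl] at *
    rw [h0]
    unfold Hsum
    refine Finset.sum_congr rfl fun x _ => ?_
    rcases le_or_gt x (-1) with hx | hx
    · rw [IsLCTail.pmf, flowTail_of_nonpos _ _ _ _ _ (by omega), flowTail_of_nonpos _ _ _ _ _ (by omega)]
      ring
    · rw [flowTail_of_nonpos _ _ _ _ _ (by omega), flowTail_of_nonpos _ _ _ _ _ (by omega)]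
  · have e : k = ((k.toNat : ℕ) : ℤ) := (Int.toNat_of_nonneg hk.le).symm
    rw [e]
    exact flowTail_univ_eq_Hsum p hst hE hdisj hcov hM _

/-- **strand reduction**: if both parts have log-concave flow tails, so has the parallel composition -/
theorem isLCTail_flowTail_union (p : E → ℝ) {ends : E → Sym2 V} {s t : V} (hst : s ≠ t)
    {E₁ E₂ : Finset E} (hE : SharesOnlyTerminals ends s t E₁ E₂) (hdisj : Disjoint E₁ E₂)
    (hcov : E₁ ∪ E₂ = Finset.univ)
    (h₁ : IsLCTail (flowTail p ends s t E₁) ((E₁.card : ℤ) + 1))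
    (h₂ : IsLCTail (flowTail p ends s t E₂) ((E₂.card : ℤ) + 1)) :
    IsLCTail (flowTail p ends s t Finset.univ) ((E₂.card : ℤ) + 1 + ((E₁.card : ℤ) + 1)) := by
  have hfun : flowTail p ends s t Finset.univ
      = Hsum (flowTail p ends s t E₂) (flowTail p ends s t E₁) ((E₁.card : ℤ) + 2) :=
    funext fun k => flowTail_univ_eq_Hsum_all p hst hE hdisj hcov (by omega) k
  rw [hfun]
  exact Hsum_isLCTail h₂ h₁ (by omega) (by omega)

/-- **row B2 for a parallel composition whose parts satisfy it** -/
theorem flow_logconcave_of_parts {p : E → ℝ} (hp : IsProbVec p) {ends : E → Sym2 V} {s t : V}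
    (hst : s ≠ t) {E₁ E₂ : Finset E} (hE : SharesOnlyTerminals ends s t E₁ E₂) (hdisj : Disjoint E₁ E₂)
    (hcov : E₁ ∪ E₂ = Finset.univ)
    (hlc₁ : ∀ k : ℕ, prob p (flowIn ends s t E₁ k) * prob p (flowIn ends s t E₁ (k + 2))
      ≤ prob p (flowIn ends s t E₁ (k + 1)) * prob p (flowIn ends s t E₁ (k + 1)))
    (hlc₂ : ∀ k : ℕ, prob p (flowIn ends s t E₂ k) * prob p (flowIn ends s t E₂ (k + 2))
      ≤ prob p (flowIn ends s t E₂ (k + 1)) * prob p (flowIn ends s t E₂ (k + 1)))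
    (k : ℕ) :
    prob p (flowEvent ends s t k) * prob p (flowEvent ends s t (k + 2))
      ≤ prob p (flowEvent ends s t (k + 1)) * prob p (flowEvent ends s t (k + 1)) := by
  have h := isLCTail_flowTail_union p hst hE hdisj hcov (isLCTail_flowTail hp hst E₁ hlc₁)
    (isLCTail_flowTail hp hst E₂ hlc₂)
  have hk := h.lc ((k : ℤ) + 1)
  have e1 : ((k : ℤ) + 1 - 1) = (k : ℤ) := by ring
  have e2 : ((k : ℤ) + 1 + 1) = ((k + 2 : ℕ) : ℤ) := by push_cast; ring
  have e3 : ((k : ℤ) + 1) = ((k + 1 : ℕ) : ℤ) := by push_cast; ring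
  rw [e1, e2, e3, flowTail_natCast, flowTail_natCast, flowTail_natCast, flowIn_univ, flowIn_univ,
    flowIn_univ] at hk
  exact hk

open Classical in
/-- the flow inside a part as a weighted sum (the event is the `k`-fold disjoint occurrence of
`S ↦ Carries (S ∩ E₁)`) -/
lemma prob_flowIn_eq_sum_wt (p : E → ℝ) (ends : E → Sym2 V) (s t : V) (E₁ : Finset E) (k : ℕ) :
    prob p (flowIn ends s t E₁ k)
      = ∑ S ∈ Finset.univ.powerset.filter (kDisj (fun S => Carries ends (S ∩ E₁) s t) k),
          ReimerCube.wt Finset.univ p S := by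
  rw [prob_eq_sum_wt]
  apply sum_filter_congr_pred
  intro S
  simp only [flowIn, Set.mem_setOf_eq, openSet_ofFinset]
  exact kDisj_inter_iff ends s t E₁ k S

omit [Fintype E] in
/-- `S ↦ Carries (S ∩ E₁)` is increasing -/
lemma incr_carries_inter (ends : E → Sym2 V) (s t : V) (E₁ : Finset E) :
    ReimerCube.Incr (fun S : Finset E => Carries ends (S ∩ E₁) s t) :=
  fun _ _ h hS => Carries.mono (Finset.inter_subset_inter h le_rfl) hS

/-- **BK inside a part**: `P(F₁ ≥ 2) ≤ P(F₁ ≥ 1)²` -/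
theorem prob_flowIn_two_le {p : E → ℝ} (hp : IsProbVec p) (ends : E → Sym2 V) (s t : V) (E₁ : Finset E) :
    prob p (flowIn ends s t E₁ 2) ≤ prob p (flowIn ends s t E₁ 1) * prob p (flowIn ends s t E₁ 1) := by
  classical
  have hp' : ∀ i, 0 ≤ p i ∧ p i ≤ 1 := fun i => ⟨hp.nonneg i, hp.le_one i⟩
  rw [prob_flowIn_eq_sum_wt, prob_flowIn_eq_sum_wt]
  have h := kDisj_succ_le p hp' _ (incr_carries_inter ends s t E₁) 1
  have h1 : (∑ S ∈ Finset.univ.powerset.filter (kDisj (fun S => Carries ends (S ∩ E₁) s t) 1),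
      ReimerCube.wt Finset.univ p S)
      = ∑ S ∈ Finset.univ.powerset.filter (fun S => Carries ends (S ∩ E₁) s t), ReimerCube.wt Finset.univ p S := by
    apply sum_filter_congr_pred
    intro S
    exact kDisj_one_iff (incr_carries_inter ends s t E₁) S
  rw [h1] at h ⊢
  exact h

/-- **a part with no three disjoint paths has a log-concave flow tail (by BK alone)** -/
theorem flowIn_logconcave_of_no_three {p : E → ℝ} (hp : IsProbVec p) (ends : E → Sym2 V) (s t : V)
    (E₁ : Finset E) (h3 : flowIn ends s t E₁ 3 = ∅) (k : ℕ) :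
    prob p (flowIn ends s t E₁ k) * prob p (flowIn ends s t E₁ (k + 2))
      ≤ prob p (flowIn ends s t E₁ (k + 1)) * prob p (flowIn ends s t E₁ (k + 1)) := by
  rcases k with _ | k
  · rw [flowIn_zero, prob_univ, one_mul]
    exact prob_flowIn_two_le hp ends s t E₁
  · have hvan : flowIn ends s t E₁ (k + 1 + 2) = ∅ := by
      apply Set.eq_empty_of_subset_empty
      rw [← h3]
      have hmono : ∀ n, flowIn ends s t E₁ (3 + n) ⊆ flowIn ends s t E₁ 3 := by
        intro n
        induction n with
        | zero => simp
        | succ n ih => exact (flowIn_succ_subset ends s t E₁ _).trans ih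
      have e : k + 1 + 2 = 3 + k := by omega
      rw [e]; exact hmono k
    rw [hvan, prob_empty, mul_zero]
    exact mul_nonneg (prob_nonneg hp _) (prob_nonneg hp _)

/-- **Row B2 beyond series–parallel**: on a graph that is the parallel composition of two parts
sharing only the terminals, each carrying at most two edge-disjoint `s–t` paths, the max-flow has a
log-concave tail for every product measure: `P(F ≥ k)·P(F ≥ k+2) ≤ P(F ≥ k+1)²` (the Wheatstone
bridge with a direct `s–t` edge = `K₄` with adjacent terminals is the smallest instance). -/
theorem flow_logconcave_of_two_small_parts {p : E → ℝ} (hp : IsProbVec p) {ends : E → Sym2 V}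
    {s t : V} (hst : s ≠ t) {E₁ E₂ : Finset E} (hE : SharesOnlyTerminals ends s t E₁ E₂)
    (hdisj : Disjoint E₁ E₂) (hcov : E₁ ∪ E₂ = Finset.univ)
    (h₁ : flowIn ends s t E₁ 3 = ∅) (h₂ : flowIn ends s t E₂ 3 = ∅) (k : ℕ) :
    prob p (flowEvent ends s t k) * prob p (flowEvent ends s t (k + 2))
      ≤ prob p (flowEvent ends s t (k + 1)) * prob p (flowEvent ends s t (k + 1)) :=
  flow_logconcave_of_parts hp hst hE hdisj hcov (flowIn_logconcave_of_no_three hp ends s t E₁ h₁)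
    (flowIn_logconcave_of_no_three hp ends s t E₂ h₂) k

end Main


end Summit.Ventures.PercRepro2
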